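import Mathlib
import Summits.Ventures.Crystal3D.Theorems.StickyWulffConstantTextureLiminfTentBilayerPrelude
import Summits.Ventures.Crystal3D.Theorems.StickyWulffConstantTextureLiminfTexShadowCertificateDefs
import Literature.Analysis.Convexity.AnisotropicPerimeterLocalized
import HarnessLib

/-!
# The tent certificate — transport of polytope pieces, localisation of `perKIn`, and the bilayer double count (eng g9)

Route `StickyWulffConstant` (`Summits/Ventures/Crystal3D`, cell `crystal3d-full`), support toward the crux
`TextureLiminf` (stmt-Ventures-19483), line TexShadow v6.2, stub `stub_barlowFreeCertificate`, step (3)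
(assembly over the bilayers):
* `image_polytope_motion` — a rigid motion `x ↦ T x + c` carries the open `H`-polytope of `H` onto the open
  `H`-polytope of the moved data `(T a, b + ⟪T a, c⟫)`; unit normals, distinct facet planes and boundedness are
  preserved;
* `perKIn_eq_anisotropicPerimeterIn` (`rfl`: the line's `perKIn` IS lit's localized perimeter) and
  `anisotropicPerimeterIn_inter_of_subset` — `P_K(G; V) = P_K(G ∩ W; V)` for `V ⊆ W` measurable (fields supported
  in `V` do not see `G ∖ W`);
* `sum_ncard_le_two_mul_ncard` — THE BILAYER DOUBLE COUNT: if, for `i` in a finite index set, `P i` are sets of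
  "in-plane" pairs (both ends at the same height `i h` or `(i+1) h`) and `Q i` sets of "inter-layer" pairs (ends at
  heights `{i h, (i+1) h}`) inside a finite set `BB` of pairs, then `Σ_i (#P i + 2 #Q i) ≤ 2 #BB` — every
  in-plane pair is seen by at most the two bilayers `i, i-1`, every inter-layer pair by exactly one.
WHAT THIS IS NOT: the certificate; F-C1 not moved.
-/

noncomputable section

namespace Summit.Ventures.Crystal3D.TentCertificate

open Finset Summit.Ventures.Crystal3D MeasureTheory Literature.Analysis.Convexity
open Literature.MathematicalPhysics.StatisticalMechanics (fieldDivergence)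
open Summit.Ventures.Crystal3D.Cruxes.TextureLiminf.TexShadow (polytope perKIn)
open scoped RealInnerProductSpace ENNReal

/-! ## Transport of polytope pieces under a rigid motion -/

/-- The moved `H`-data: normal `T a`, level `b + ⟪T a, c⟫`. -/
def moveH (T : E3 ≃ₗᵢ[ℝ] E3) (c : E3) (H : Finset (E3 × ℝ)) : Finset (E3 × ℝ) :=
  H.image fun p => (T p.1, p.2 + ⟪T p.1, c⟫)

/-- **A rigid motion carries the open polytope of `H` onto the open polytope of the moved data.** -/
theorem image_polytope_motion (T : E3 ≃ₗᵢ[ℝ] E3) (c : E3) (H : Finset (E3 × ℝ)) :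
    (fun x => T x + c) '' polytope H = polytope (moveH T c H) := by
  ext y
  simp only [polytope, moveH, Set.mem_image, Set.mem_iInter, Set.mem_setOf_eq, Finset.mem_image]
  constructor
  · rintro ⟨x, hx, rfl⟩ q ⟨p, hp, rfl⟩
    simp only
    rw [inner_add_right, T.inner_map_map]
    linarith [hx p hp]
  · intro hy
    refine ⟨T.symm (y - c), fun p hp => ?_, by simp⟩
    have := hy (T p.1, p.2 + ⟪T p.1, c⟫) ⟨p, hp, rfl⟩
    simp only at this
    rw [← T.inner_map_map, T.apply_symm_apply, inner_sub_right]
    linarith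

/-- Moved normals are unit normals. -/
theorem norm_moveH {T : E3 ≃ₗᵢ[ℝ] E3} {c : E3} {H : Finset (E3 × ℝ)} (h1 : ∀ p ∈ H, ‖p.1‖ = 1) :
    ∀ q ∈ moveH T c H, ‖q.1‖ = 1 := by
  intro q hq
  obtain ⟨p, hp, rfl⟩ := Finset.mem_image.1 hq
  simp only [LinearIsometryEquiv.norm_map]; exact h1 p hp

/-- The facet plane of a moved constraint is the moved facet plane. -/
theorem plane_moveH (T : E3 ≃ₗᵢ[ℝ] E3) (c : E3) (p : E3 × ℝ) :
    {x : E3 | ⟪T p.1, x⟫ = p.2 + ⟪T p.1, c⟫} = (fun x => T x + c) '' {x : E3 | ⟪p.1, x⟫ = p.2} := by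
  ext y
  simp only [Set.mem_setOf_eq, Set.mem_image]
  constructor
  · intro hy
    refine ⟨T.symm (y - c), ?_, by simp⟩
    rw [← T.inner_map_map, T.apply_symm_apply, inner_sub_right]; linarith
  · rintro ⟨x, hx, rfl⟩
    rw [inner_add_right, T.inner_map_map, hx]

/-- Moved facet planes stay pairwise distinct. -/
theorem plane_ne_moveH {T : E3 ≃ₗᵢ[ℝ] E3} {c : E3} {H : Finset (E3 × ℝ)}
    (hd : ∀ p ∈ H, ∀ p' ∈ H, p ≠ p' → {x : E3 | ⟪p.1, x⟫ = p.2} ≠ {x | ⟪p'.1, x⟫ = p'.2}) :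
    ∀ q ∈ moveH T c H, ∀ q' ∈ moveH T c H, q ≠ q' → {x : E3 | ⟪q.1, x⟫ = q.2} ≠ {x | ⟪q'.1, x⟫ = q'.2} := by
  intro q hq q' hq' hne heq
  obtain ⟨p, hp, rfl⟩ := Finset.mem_image.1 hq
  obtain ⟨p', hp', rfl⟩ := Finset.mem_image.1 hq'
  have hpp : p ≠ p' := fun h => hne (by rw [h])
  apply hd p hp p' hp' hpp
  simp only at heq
  rw [plane_moveH, plane_moveH] at heq
  exact (Set.image_injective.2 (fun x y hxy => T.injective (add_right_cancel hxy))) heq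

/-- Moved pieces stay bounded. -/
theorem isBounded_polytope_moveH {T : E3 ≃ₗᵢ[ℝ] E3} {c : E3} {H : Finset (E3 × ℝ)}
    (hb : Bornology.IsBounded (polytope H)) : Bornology.IsBounded (polytope (moveH T c H)) := by
  rw [← image_polytope_motion]
  obtain ⟨R, hR⟩ := (Metric.isBounded_iff_subset_closedBall 0).1 hb
  refine (Metric.isBounded_iff_subset_closedBall c).2 ⟨R, ?_⟩
  rintro _ ⟨x, hx, rfl⟩
  have := hR hx
  rw [Metric.mem_closedBall, dist_zero_right] at this
  rw [Metric.mem_closedBall, dist_eq_norm, add_sub_cancel_right, T.norm_map]; exact this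

/-! ## The line's `perKIn` is lit's localized perimeter; localisation in the set argument -/

/-- The line's localized perimeter `perKIn` IS `Literature.Analysis.Convexity.anisotropicPerimeterIn`. -/
theorem perKIn_eq_anisotropicPerimeterIn (K G U : Set E3) : perKIn K G U = anisotropicPerimeterIn K G U := rfl

/-- **Localisation**: fields supported in `V ⊆ W` do not see `G ∖ W`: `P_K(G; V) = P_K(G ∩ W; V)`. -/
theorem anisotropicPerimeterIn_inter_of_subset (K G : Set E3) {V W : Set E3} (hW : MeasurableSet W)
    (hVW : V ⊆ W) : anisotropicPerimeterIn K G V = anisotropicPerimeterIn K (G ∩ W) V := by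
  unfold anisotropicPerimeterIn
  refine iSup_congr fun ξ => iSup_congr fun hξ => ?_
  rw [setIntegral_fieldDivergence_inter_eq hξ.1 hξ.2.1 hW (hξ.2.2.2.trans hVW)]

/-! ## The bilayer double count -/

/-- **The bilayer double count.**  `BB` a finite set of pairs, `ht` a height function, `h ≠ 0`; for `i ∈ I`,
`P i ⊆ BB` consists of pairs with equal heights `∈ {i h, (i+1) h}` and `Q i ⊆ BB` of pairs with heights
`{i h, (i+1) h}` (in some order).  Then `Σ_{i ∈ I} (#P i + 2 · #Q i) ≤ 2 · #BB`. -/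
theorem sum_ncard_le_two_mul_ncard {α : Type*} {BB : Set (α × α)} (hBB : BB.Finite) (ht : α → ℝ)
    {h : ℝ} (hh : h ≠ 0) (I : Finset ℤ) (P Q : ℤ → Set (α × α))
    (hP : ∀ i ∈ I, P i ⊆ {p | p ∈ BB ∧ ht p.1 = ht p.2 ∧ (ht p.1 = i * h ∨ ht p.1 = (i + 1) * h)})
    (hQ : ∀ i ∈ I, Q i ⊆ {p | p ∈ BB ∧
      ((ht p.1 = i * h ∧ ht p.2 = (i + 1) * h) ∨ (ht p.1 = (i + 1) * h ∧ ht p.2 = i * h))}) :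
    ∑ i ∈ I, ((P i).ncard + 2 * (Q i).ncard) ≤ 2 * BB.ncard := by
  classical
  set B : Finset (α × α) := hBB.toFinset with hB
  have hmemB : ∀ p, p ∈ B ↔ p ∈ BB := fun p => by simp [hB]
  -- same-height pairs at height `k h`, and inter-layer pairs of bilayer `i`
  let BS : ℤ → Finset (α × α) := fun k => B.filter fun p => ht p.1 = ht p.2 ∧ ht p.1 = k * h
  let BD : ℤ → Finset (α × α) := fun i => B.filter fun p =>
    (ht p.1 = i * h ∧ ht p.2 = (i + 1) * h) ∨ (ht p.1 = (i + 1) * h ∧ ht p.2 = i * h)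
  let Bsame : Finset (α × α) := B.filter fun p => ht p.1 = ht p.2
  let Bdiff : Finset (α × α) := B.filter fun p => ¬ ht p.1 = ht p.2
  have hsplit : Bsame.card + Bdiff.card = B.card := Finset.card_filter_add_card_filter_not _
  have hBcard : B.card = BB.ncard := by rw [hB, Set.ncard_eq_toFinset_card BB hBB]
  -- integer heights are injective in the index
  have hinj : ∀ {k k' : ℤ}, (k : ℝ) * h = k' * h → k = k' := fun e => by exact_mod_cast mul_right_cancel₀ hh e
  -- per-index bounds
  have hPi : ∀ i ∈ I, (P i).ncard ≤ (BS i).card + (BS (i + 1)).card := by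
    intro i hi
    have hsub : P i ⊆ ↑(BS i ∪ BS (i + 1)) := by
      intro p hp
      obtain ⟨hpB, heq, hk⟩ := hP i hi hp
      rw [Finset.coe_union, Set.mem_union, Finset.mem_coe, Finset.mem_coe]
      rcases hk with hk | hk
      · exact Or.inl (Finset.mem_filter.2 ⟨(hmemB p).2 hpB, heq, hk⟩)
      · exact Or.inr (Finset.mem_filter.2 ⟨(hmemB p).2 hpB, heq, by push_cast; exact hk⟩)
    calc (P i).ncard ≤ (↑(BS i ∪ BS (i + 1)) : Set (α × α)).ncard :=
          Set.ncard_le_ncard hsub (Finset.finite_toSet _)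
      _ = (BS i ∪ BS (i + 1)).card := Set.ncard_coe_finset _
      _ ≤ (BS i).card + (BS (i + 1)).card := Finset.card_union_le _ _
  have hQi : ∀ i ∈ I, (Q i).ncard ≤ (BD i).card := by
    intro i hi
    have hsub : Q i ⊆ ↑(BD i) := by
      intro p hp
      obtain ⟨hpB, hk⟩ := hQ i hi hp
      exact Finset.mem_filter.2 ⟨(hmemB p).2 hpB, hk⟩
    calc (Q i).ncard ≤ (↑(BD i) : Set (α × α)).ncard := Set.ncard_le_ncard hsub (Finset.finite_toSet _)
      _ = (BD i).card := Set.ncard_coe_finset _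
  -- the same-height families are disjoint subfamilies of `Bsame`
  have hBS_disj : ∀ k k', k ≠ k' → Disjoint (BS k) (BS k') := by
    intro k k' hne
    rw [Finset.disjoint_filter]
    rintro p _ ⟨_, h1⟩ ⟨_, h2⟩
    exact hne (hinj (h1.symm.trans h2))
  have hBS_sub : ∀ k, BS k ⊆ Bsame := fun k => Finset.monotone_filter_right _ fun p _ hp => hp.1
  have hsumS : ∀ f : ℤ → ℤ, Function.Injective f → ∑ i ∈ I, (BS (f i)).card ≤ Bsame.card := by
    intro f hf
    rw [← Finset.card_biUnion (fun i _ j _ hij => hBS_disj _ _ fun e => hij (hf e))]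
    exact Finset.card_le_card (Finset.biUnion_subset.2 fun i _ => hBS_sub _)
  -- the inter-layer families are disjoint subfamilies of `Bdiff`
  have hBD_disj : ∀ i i', i ≠ i' → Disjoint (BD i) (BD i') := by
    intro i i' hne
    rw [Finset.disjoint_filter]
    rintro p _ h1 h2
    rcases h1 with ⟨a1, b1⟩ | ⟨a1, b1⟩ <;> rcases h2 with ⟨a2, b2⟩ | ⟨a2, b2⟩
    · exact hne (hinj (a1.symm.trans a2))
    · have e1 : i = i' + 1 := hinj (by push_cast; exact a1.symm.trans a2)
      have e2 : i + 1 = i' := hinj (by push_cast; exact b1.symm.trans b2)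
      omega
    · have e1 : i + 1 = i' := hinj (by push_cast; exact a1.symm.trans a2)
      have e2 : i = i' + 1 := hinj (by push_cast; exact b1.symm.trans b2)
      omega
    · exact hne (hinj (b1.symm.trans b2))
  have hBD_sub : ∀ i, BD i ⊆ Bdiff := by
    intro i p hp
    obtain ⟨hpB, hk⟩ := Finset.mem_filter.1 hp
    refine Finset.mem_filter.2 ⟨hpB, fun heq => ?_⟩
    rcases hk with ⟨a, b⟩ | ⟨a, b⟩
    · have : (i : ℤ) = i + 1 := hinj (by push_cast; rw [← a, ← b, heq])
      omega
    · have : (i : ℤ) + 1 = i := hinj (by push_cast; rw [← a, ← b, heq])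
      omega
  have hsumD : ∑ i ∈ I, (BD i).card ≤ Bdiff.card := by
    rw [← Finset.card_biUnion (fun i _ j _ hij => hBD_disj _ _ hij)]
    exact Finset.card_le_card (Finset.biUnion_subset.2 fun i _ => hBD_sub _)
  -- assemble
  have h1 := hsumS id Function.injective_id
  have h2 := hsumS (fun i => i + 1) (fun a b e => by simpa using e)
  simp only [id] at h1
  calc ∑ i ∈ I, ((P i).ncard + 2 * (Q i).ncard)
      ≤ ∑ i ∈ I, ((BS i).card + (BS (i + 1)).card + 2 * (BD i).card) :=
        Finset.sum_le_sum fun i hi => by linarith [hPi i hi, hQi i hi]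
    _ = ∑ i ∈ I, (BS i).card + ∑ i ∈ I, (BS (i + 1)).card + 2 * ∑ i ∈ I, (BD i).card := by
        rw [Finset.mul_sum, ← Finset.sum_add_distrib, ← Finset.sum_add_distrib]
    _ ≤ Bsame.card + Bsame.card + 2 * Bdiff.card := by gcongr
    _ = 2 * BB.ncard := by rw [← hBcard, ← hsplit]; ring

end Summit.Ventures.Crystal3D.TentCertificate

end
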